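import Literature.NumberTheory.LFunctions.SuzukiScrewLine
import Literature.NumberTheory.LFunctions.WeilExplicit
import HarnessLib

/-!
# Suzuki's test function `φ_{z,t}` for CJM Prop 3.1 and its compactly supported combination

LINE 1 — LABEL: RH-FREE definitions and elementary closed forms (support / continuity / Lipschitz /
Mellin transform of an explicit piecewise-exponential function).  bears_on: LADDER-RH B-C/B-P
(COLUMN 6 DBR) as infrastructure for the explicit-formula half of CJM Prop 3.1
(`Suzuki2025_prop31`, `SuzukiScrewLine.lean`).  WHAT THIS IS NOT: no explicit formula is applied
here, no fact is asserted or discharged; nothing here bears on the truth of RH.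

SOURCE. M. Suzuki, *On the Hilbert space derived from the Weil distribution*, Canad. J. Math. (2025)
= arXiv:2301.00421v3 [`Suzuki2025WeilHilbertSpace`], proof of Prop 3.1, TeX l.795–826.

## What is typed

* `suzukiPhi z t` — the test function of the printed proof (TeX l.795–801), for `t ≥ 0`, `z ∈ ℂ`:
  `φ_{z,t}(x) = (iz)⁻¹e^{izx}(e^{−izt} − 1)` for `t < x`, `= (iz)⁻¹e^{izx}(e^{−izx} − 1)` for
  `0 ≤ x ≤ t`, `= 0` for `x < 0` (the value at `x = 0` is `0` on both readings, `suzukiPhi_zero`).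
* `suzukiPhiCoeff z t = (e^{−izt} − 1)⁻¹` and the COMPACTLY SUPPORTED combination
  `suzukiPhiC z t t' = c_t φ_{z,t} − c_{t'} φ_{z,t'}` [folklore device]: for `x > max t t'` both terms
  equal `(iz)⁻¹e^{izx}` and cancel (`suzukiPhiC_of_max_lt`), so `suzukiPhiC z t t'` is continuous,
  supported in `[0, max t t']` (`hasCompactSupport_suzukiPhiC`), Lipschitz
  (`lipschitzWith_suzukiPhiC`), and vanishes at `0` — an admissible input for the tree's explicit
  formula for continuous compactly supported Lipschitz test functions
  (`explicit_formula_continuous_bombieri`, `WeilExplicitBombieriLipschitz.lean`).  The printed proof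
  applies (3.3) to `φ_{z,t}` itself («As is easily seen, Weil's explicit formula can be applied to
  `φ(x) = φ_{z,t}(x)`», TeX l.819); the tree's (3.3) is stated for compactly supported test functions,
  and the combination carries exactly the `t`-dependence needed downstream
  (`Suzuki2025_prop31_of_sub_eq_const_mul`, `SuzukiScrewLinePinningProofs.lean`).
* `weilMellin_suzukiPhiC` — the zero-side transform in closed form: with `γ = suzukiZeroParam ρ`
  (`= i(ρ − ½)`, so `e^{(ρ−½)x} = e^{−iγx}` and `weilMellin φ ρ = ∫ φ(x)e^{−iγx}dx = φ̂(−γ)`),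
  `weilMellin (suzukiPhiC z t t') ρ = c_t·(e^{−iγt} − 1)/(γ(z − γ)) − c_{t'}·(e^{−iγt'} − 1)/(γ(z − γ))`
  for `γ ∉ {0, z}` — the printed `∫ φ_{z,t}(x)e^{−iγx}dx = (e^{−iγt} − 1)/γ · 1/(z − γ)` (TeX l.822–826,
  there for `Im z > Im γ`; for the compact combination the tails cancel identically and no half-plane
  condition is needed).  The summand shape is that of `screwZeroExpansion` (CJM (3.2)).

* (append v2) `norm_weilMellin_suzukiPhiC_le` — `‖ĝ(ρ)‖ ≤ N(z,t,t')/(‖γ‖‖z − γ‖)` across the strip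
  (input for the absolute convergence of the zero side); `weilPolarTerm_suzukiPhiC` — TeX l.836–840,
  `ĝ(0) + ĝ(1) = c_t·[4(e^{t/2}−1)/(1+2iz) + 4(e^{−t/2}−1)/(1−2iz)] − c_{t'}·[…]` (first two terms of
  `screwP`), a corollary of the Mellin closed form at `γ = ±i/2`; `weilPrimeTerm_suzukiPhiC_of_le` —
  TeX l.841–861 for the compact combination: the two `ζ'/ζ(½ − iz)` contributions cancel and the
  prime term is the finite sum `−(c_t·Σ_{n≤e^t}Λ(n)n^{−1/2}(e^{−iz(t−log n)}−1)/(iz) − c_{t'}·Σ_{n≤e^{t'}}…)`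
  (fourth term of `screwP`).  What remains for Prop 3.1 (not here): the Bombieri archimedean term of
  `g_{z;t,t'}` (TeX l.866–975, Lerch `Φ` and the digamma series) and the integrability input `hA` of
  `explicit_formula_continuous_bombieri`.

## References

* M. Suzuki, Canad. J. Math. (2025), doi:10.4153/S0008414X25101739 = arXiv:2301.00421v3, proof of
  Prop. 3.1. [Suzuki2025WeilHilbertSpace]
-/

noncomputable section

open MeasureTheory Complex Filter Set
open scoped Topology NNReal

namespace Literature.NumberTheory.LFunctions

/-! ## The test function `φ_{z,t}` and the combination `c_t φ_{z,t} − c_{t'} φ_{z,t'}` -/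

/-- RH-FREE object. **Suzuki's test function `φ_{z,t}`** (proof of CJM Prop 3.1, TeX l.795–801), for
`t ≥ 0` and `z ∈ ℂ`: `φ_{z,t}(x) = (iz)⁻¹ e^{izx}(e^{−izt} − 1)` for `t < x`,
`(iz)⁻¹ e^{izx}(e^{−izx} − 1)` for `0 ≤ x ≤ t`, and `0` for `x < 0` (typed with `x ≤ 0 ↦ 0`; at
`x = 0` the printed middle expression is `0` as well). [cite: Suzuki2025WeilHilbertSpace, proof of Prop. 3.1 (TeX l.795–801)] -/
def suzukiPhi (z : ℂ) (t x : ℝ) : ℂ :=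
  if x ≤ 0 then 0
  else if x ≤ t then (I * z)⁻¹ * cexp (I * z * x) * (cexp (-(I * z * x)) - 1)
  else (I * z)⁻¹ * cexp (I * z * x) * (cexp (-(I * z * t)) - 1)

/-- RH-FREE object. The normalising constant `c_t(z) := (e^{−izt} − 1)⁻¹` (finite for `Im z > 0`,
`t > 0`, `cexp_neg_I_mul_ne_one`). [folklore] -/
def suzukiPhiCoeff (z : ℂ) (t : ℝ) : ℂ :=
  (cexp (-(I * z * t)) - 1)⁻¹

/-- RH-FREE object. The compactly supported combination
`g_{z;t,t'} := c_t φ_{z,t} − c_{t'} φ_{z,t'}` of two of Suzuki's test functions: for `x > max t t'`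
both terms equal `(iz)⁻¹e^{izx}` and cancel (`suzukiPhiC_of_max_lt`). [folklore] -/
def suzukiPhiC (z : ℂ) (t t' : ℝ) (x : ℝ) : ℂ :=
  suzukiPhiCoeff z t * suzukiPhi z t x - suzukiPhiCoeff z t' * suzukiPhi z t' x

/-! ## Piecewise description -/

/-- `φ_{z,t}(x) = 0` for `x ≤ 0`. [cite: Suzuki2025WeilHilbertSpace, proof of Prop. 3.1 (TeX l.795–801)] -/
theorem suzukiPhi_of_nonpos (z : ℂ) (t : ℝ) {x : ℝ} (hx : x ≤ 0) : suzukiPhi z t x = 0 := by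
  simp [suzukiPhi, hx]

/-- `φ_{z,t}(0) = 0`. [cite: Suzuki2025WeilHilbertSpace, proof of Prop. 3.1 (TeX l.861)] -/
theorem suzukiPhi_zero (z : ℂ) (t : ℝ) : suzukiPhi z t 0 = 0 :=
  suzukiPhi_of_nonpos z t le_rfl

/-- On `0 < x ≤ t`: `φ_{z,t}(x) = (iz)⁻¹(1 − e^{izx})` (`e^{izx}(e^{−izx} − 1) = 1 − e^{izx}`).
[cite: Suzuki2025WeilHilbertSpace, proof of Prop. 3.1 (TeX l.795–801)] -/
theorem suzukiPhi_of_mem (z : ℂ) {t x : ℝ} (hx : 0 < x) (hxt : x ≤ t) :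
    suzukiPhi z t x = (I * z)⁻¹ * (1 - cexp (I * z * x)) := by
  rw [suzukiPhi, if_neg (not_le.2 hx), if_pos hxt, mul_assoc, mul_sub, mul_one, ← Complex.exp_add,
    add_neg_cancel, Complex.exp_zero]

/-- On `0 ≤ x ≤ t`: `φ_{z,t}(x) = (iz)⁻¹(1 − e^{izx})`. [cite: Suzuki2025WeilHilbertSpace, proof of Prop. 3.1 (TeX l.795–801)] -/
theorem suzukiPhi_of_mem' (z : ℂ) {t x : ℝ} (hx : 0 ≤ x) (hxt : x ≤ t) :
    suzukiPhi z t x = (I * z)⁻¹ * (1 - cexp (I * z * x)) := by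
  rcases hx.eq_or_lt with rfl | hx
  · simp [suzukiPhi]
  · exact suzukiPhi_of_mem z hx hxt

/-- On `t < x` (`t ≥ 0`): `φ_{z,t}(x) = (iz)⁻¹e^{izx}(e^{−izt} − 1)`.
[cite: Suzuki2025WeilHilbertSpace, proof of Prop. 3.1 (TeX l.795–801)] -/
theorem suzukiPhi_of_lt (z : ℂ) {t x : ℝ} (ht : 0 ≤ t) (htx : t < x) :
    suzukiPhi z t x = (I * z)⁻¹ * cexp (I * z * x) * (cexp (-(I * z * t)) - 1) := by
  rw [suzukiPhi, if_neg (not_le.2 (ht.trans_lt htx)), if_neg (not_le.2 htx)]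

/-- `c_t (e^{−izt} − 1) = 1` when `e^{−izt} ≠ 1`. [cite: Suzuki2025WeilHilbertSpace, proof of Prop. 3.1 (TeX l.795–826)] -/
theorem suzukiPhiCoeff_mul (z : ℂ) {t : ℝ} (h : cexp (-(I * z * t)) ≠ 1) :
    suzukiPhiCoeff z t * (cexp (-(I * z * t)) - 1) = 1 :=
  inv_mul_cancel₀ (sub_ne_zero.2 h)

/-- For `Im z > 0` and `t > 0`, `e^{−izt} ≠ 1` (`|e^{−izt}| = e^{t·Im z} > 1`). [cite: Suzuki2025WeilHilbertSpace, proof of Prop. 3.1 (TeX l.795–826)] -/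
theorem cexp_neg_I_mul_ne_one {z : ℂ} (hz : 0 < z.im) {t : ℝ} (ht : 0 < t) :
    cexp (-(I * z * t)) ≠ 1 := by
  intro h
  have h1 := congrArg (‖·‖) h
  simp only [Complex.norm_exp, norm_one] at h1
  have hre : (-(I * z * (t : ℂ))).re = z.im * t := by
    simp [Complex.mul_re, Complex.mul_im]
  rw [hre, Real.exp_eq_one_iff] at h1
  exact (mul_pos hz ht).ne' h1

/-- Beyond `t`: `c_t φ_{z,t}(x) = (iz)⁻¹e^{izx}` — the `t`-INDEPENDENT tail. [cite: Suzuki2025WeilHilbertSpace, proof of Prop. 3.1 (TeX l.795–826)] -/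
theorem suzukiPhiCoeff_mul_suzukiPhi_of_lt (z : ℂ) {t x : ℝ} (ht : 0 ≤ t) (htx : t < x)
    (h : cexp (-(I * z * t)) ≠ 1) :
    suzukiPhiCoeff z t * suzukiPhi z t x = (I * z)⁻¹ * cexp (I * z * x) := by
  rw [suzukiPhi_of_lt z ht htx, show suzukiPhiCoeff z t * ((I * z)⁻¹ * cexp (I * z * x) *
      (cexp (-(I * z * t)) - 1)) = (I * z)⁻¹ * cexp (I * z * x) *
        (suzukiPhiCoeff z t * (cexp (-(I * z * t)) - 1)) by ring, suzukiPhiCoeff_mul z h, mul_one]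

/-- `g_{z;t,t'}(x) = 0` for `x ≤ 0`. [cite: Suzuki2025WeilHilbertSpace, proof of Prop. 3.1 (TeX l.795–826)] -/
theorem suzukiPhiC_of_nonpos (z : ℂ) (t t' : ℝ) {x : ℝ} (hx : x ≤ 0) : suzukiPhiC z t t' x = 0 := by
  simp [suzukiPhiC, suzukiPhi_of_nonpos z _ hx]

/-- `g_{z;t,t'}(0) = 0`. [cite: Suzuki2025WeilHilbertSpace, proof of Prop. 3.1 (TeX l.795–826)] -/
theorem suzukiPhiC_zero (z : ℂ) (t t' : ℝ) : suzukiPhiC z t t' 0 = 0 :=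
  suzukiPhiC_of_nonpos z t t' le_rfl

/-- `g_{z;t,t'}(x) = 0` for `x > max t t'` (the tails cancel). [cite: Suzuki2025WeilHilbertSpace, proof of Prop. 3.1 (TeX l.795–826)] -/
theorem suzukiPhiC_of_max_lt (z : ℂ) {t t' x : ℝ} (ht : 0 ≤ t) (ht' : 0 ≤ t')
    (h1 : cexp (-(I * z * t)) ≠ 1) (h2 : cexp (-(I * z * t')) ≠ 1) (hx : max t t' < x) :
    suzukiPhiC z t t' x = 0 := by
  rw [suzukiPhiC, suzukiPhiCoeff_mul_suzukiPhi_of_lt z ht ((le_max_left _ _).trans_lt hx) h1,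
    suzukiPhiCoeff_mul_suzukiPhi_of_lt z ht' ((le_max_right _ _).trans_lt hx) h2, sub_self]

/-- Antisymmetry: `g_{z;t',t} = −g_{z;t,t'}`. [cite: Suzuki2025WeilHilbertSpace, proof of Prop. 3.1 (TeX l.795–826)] -/
theorem suzukiPhiC_swap (z : ℂ) (t t' x : ℝ) : suzukiPhiC z t' t x = -suzukiPhiC z t t' x := by
  simp only [suzukiPhiC]; ring

/-- On `0 ≤ x ≤ min t t'`: `g_{z;t,t'}(x) = (c_t − c_{t'})(iz)⁻¹(1 − e^{izx})`. [cite: Suzuki2025WeilHilbertSpace, proof of Prop. 3.1 (TeX l.795–826)] -/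
theorem suzukiPhiC_of_le_of_le (z : ℂ) {t t' x : ℝ} (hx : 0 ≤ x) (hxt : x ≤ t) (hxt' : x ≤ t') :
    suzukiPhiC z t t' x =
      (suzukiPhiCoeff z t - suzukiPhiCoeff z t') * ((I * z)⁻¹ * (1 - cexp (I * z * x))) := by
  rw [suzukiPhiC, suzukiPhi_of_mem' z hx hxt, suzukiPhi_of_mem' z hx hxt']; ring

/-- On `t < x ≤ t'` (`t ≥ 0`): `g_{z;t,t'}(x) = (iz)⁻¹e^{izx} − c_{t'}(iz)⁻¹(1 − e^{izx})`. [cite: Suzuki2025WeilHilbertSpace, proof of Prop. 3.1 (TeX l.795–826)] -/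
theorem suzukiPhiC_of_lt_of_le (z : ℂ) {t t' x : ℝ} (ht : 0 ≤ t) (htx : t < x) (hxt' : x ≤ t')
    (h1 : cexp (-(I * z * t)) ≠ 1) :
    suzukiPhiC z t t' x =
      (I * z)⁻¹ * cexp (I * z * x) - suzukiPhiCoeff z t' * ((I * z)⁻¹ * (1 - cexp (I * z * x))) := by
  rw [suzukiPhiC, suzukiPhiCoeff_mul_suzukiPhi_of_lt z ht htx h1,
    suzukiPhi_of_mem z (ht.trans_lt htx) hxt']

/-- `c_t (1 − e^{izt}) = e^{izt}` (when `e^{−izt} ≠ 1`): the pieces of `g_{z;t,t'}` agree at the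
break points. [cite: Suzuki2025WeilHilbertSpace, proof of Prop. 3.1 (TeX l.795–826)] -/
theorem suzukiPhiCoeff_mul_one_sub (z : ℂ) {t : ℝ} (h : cexp (-(I * z * t)) ≠ 1) :
    suzukiPhiCoeff z t * (1 - cexp (I * z * t)) = cexp (I * z * t) := by
  have hE : cexp (I * z * t) ≠ 0 := Complex.exp_ne_zero _
  have hne : (cexp (I * z * t))⁻¹ - 1 ≠ 0 := by
    rw [← Complex.exp_neg]; exact sub_ne_zero.2 h
  rw [suzukiPhiCoeff, Complex.exp_neg, inv_mul_eq_iff_eq_mul₀ hne, sub_mul, inv_mul_cancel₀ hE, one_mul]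

/-- `g_{z;t,t'}(t') = 0` for `0 ≤ t ≤ t'`. [cite: Suzuki2025WeilHilbertSpace, proof of Prop. 3.1 (TeX l.795–826)] -/
theorem suzukiPhiC_apply_right (z : ℂ) {t t' : ℝ} (ht : 0 ≤ t) (htt' : t ≤ t')
    (h1 : cexp (-(I * z * t)) ≠ 1) (h2 : cexp (-(I * z * t')) ≠ 1) :
    suzukiPhiC z t t' t' = 0 := by
  rcases htt'.eq_or_lt with rfl | hlt
  · simp [suzukiPhiC]
  · rw [suzukiPhiC_of_lt_of_le z ht hlt le_rfl h1]
    have hc := suzukiPhiCoeff_mul_one_sub z h2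
    linear_combination (-(I * z)⁻¹) * hc

/-! ## Continuity, support -/

/-- `x ↦ e^{izx}` is continuous on `ℝ`. [folklore] -/
private theorem continuous_cexp_I_mul (z : ℂ) : Continuous fun x : ℝ ↦ cexp (I * z * x) :=
  Complex.continuous_exp.comp (continuous_const.mul Complex.continuous_ofReal)

/-- `φ_{z,t}` is continuous for `t ≥ 0` (the three pieces agree at `x = 0` and `x = t`).
[cite: Suzuki2025WeilHilbertSpace, proof of Prop. 3.1 (TeX l.795–801)] -/
theorem continuous_suzukiPhi (z : ℂ) {t : ℝ} (ht : 0 ≤ t) : Continuous (suzukiPhi z t) := by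
  have hE := continuous_cexp_I_mul z
  have hEn : Continuous fun x : ℝ ↦ cexp (-(I * z * x)) :=
    Complex.continuous_exp.comp (continuous_const.mul Complex.continuous_ofReal).neg
  have h1 : Continuous fun x : ℝ ↦ (I * z)⁻¹ * cexp (I * z * x) * (cexp (-(I * z * x)) - 1) :=
    (continuous_const.mul hE).mul (hEn.sub continuous_const)
  have h2 : Continuous fun x : ℝ ↦ (I * z)⁻¹ * cexp (I * z * x) * (cexp (-(I * z * t)) - 1) :=
    (continuous_const.mul hE).mul continuous_const
  have hinner : Continuous fun x : ℝ ↦ if x ≤ t then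
      (I * z)⁻¹ * cexp (I * z * x) * (cexp (-(I * z * x)) - 1)
      else (I * z)⁻¹ * cexp (I * z * x) * (cexp (-(I * z * t)) - 1) :=
    h1.if_le h2 continuous_id continuous_const (fun x hx ↦ by simp [hx])
  have h := (continuous_const (y := (0 : ℂ))).if_le hinner continuous_id continuous_const
    (fun x (hx : x = 0) ↦ by subst hx; simp [ht])
  exact h

/-- `g_{z;t,t'}` is continuous (`t, t' ≥ 0`). [cite: Suzuki2025WeilHilbertSpace, proof of Prop. 3.1 (TeX l.795–826)] -/
theorem continuous_suzukiPhiC (z : ℂ) {t t' : ℝ} (ht : 0 ≤ t) (ht' : 0 ≤ t') :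
    Continuous (suzukiPhiC z t t') :=
  (continuous_const.mul (continuous_suzukiPhi z ht)).sub
    (continuous_const.mul (continuous_suzukiPhi z ht'))

/-- `g_{z;t,t'}` has compact support, contained in `[0, max t t']`. [cite: Suzuki2025WeilHilbertSpace, proof of Prop. 3.1 (TeX l.795–826)] -/
theorem hasCompactSupport_suzukiPhiC (z : ℂ) {t t' : ℝ} (ht : 0 ≤ t) (ht' : 0 ≤ t')
    (h1 : cexp (-(I * z * t)) ≠ 1) (h2 : cexp (-(I * z * t')) ≠ 1) :
    HasCompactSupport (suzukiPhiC z t t') :=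
  HasCompactSupport.intro (K := Icc 0 (max t t')) isCompact_Icc fun x hx ↦ by
    rw [mem_Icc, not_and_or, not_le, not_le] at hx
    rcases hx with hx | hx
    · exact suzukiPhiC_of_nonpos z t t' hx.le
    · exact suzukiPhiC_of_max_lt z ht ht' h1 h2 hx

/-! ## Lipschitz continuity -/

/-- Gluing Lipschitz bounds across a point of the line: if `f` is `K`-Lipschitz on `s₁ ⊆ (−∞, a]`
and on `s₂ ⊆ [a, ∞)` with `a ∈ s₁ ∩ s₂`, it is `K`-Lipschitz on `s₁ ∪ s₂`. [folklore] -/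
private theorem lipschitzOnWith_union {f : ℝ → ℂ} {K : ℝ≥0} {s₁ s₂ : Set ℝ} {a : ℝ}
    (h₁ : LipschitzOnWith K f s₁) (h₂ : LipschitzOnWith K f s₂) (ha₁ : a ∈ s₁) (ha₂ : a ∈ s₂)
    (hs₁ : ∀ x ∈ s₁, x ≤ a) (hs₂ : ∀ x ∈ s₂, a ≤ x) : LipschitzOnWith K f (s₁ ∪ s₂) := by
  have key : ∀ x ∈ s₁, ∀ y ∈ s₂, dist (f x) (f y) ≤ K * dist x y := by
    intro x hx y hy
    calc dist (f x) (f y) ≤ dist (f x) (f a) + dist (f a) (f y) := dist_triangle _ _ _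
      _ ≤ K * dist x a + K * dist a y :=
          add_le_add (h₁.dist_le_mul x hx a ha₁) (h₂.dist_le_mul a ha₂ y hy)
      _ = K * dist x y := by
          rw [Real.dist_eq, Real.dist_eq, Real.dist_eq, abs_of_nonpos (by linarith [hs₁ x hx]),
            abs_of_nonpos (by linarith [hs₂ y hy]),
            abs_of_nonpos (by linarith [hs₁ x hx, hs₂ y hy])]
          ring
  refine LipschitzOnWith.of_dist_le_mul fun x hx y hy ↦ ?_
  rcases hx with hx | hx <;> rcases hy with hy | hy
  · exact h₁.dist_le_mul x hx y hy
  · exact key x hx y hy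
  · rw [dist_comm, dist_comm x]; exact key y hy x hx
  · exact h₂.dist_le_mul x hx y hy

/-- `x ↦ e^{izx}` has derivative `iz·e^{izx}` on `ℝ`. [folklore] -/
private theorem hasDerivAt_cexp_I_mul (z : ℂ) (x : ℝ) :
    HasDerivAt (fun y : ℝ ↦ cexp (I * z * y)) (I * z * cexp (I * z * x)) x := by
  have h : HasDerivAt (fun y : ℂ ↦ cexp (I * z * y)) (cexp (I * z * x) * (I * z * 1)) (x : ℂ) :=
    (Complex.hasDerivAt_exp (I * z * x)).comp (x : ℂ) ((hasDerivAt_id (x : ℂ)).const_mul (I * z))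
  have := h.comp_ofReal
  simpa [mul_comm, mul_left_comm, mul_assoc] using this

/-- `|e^{izx}| ≤ e^{|Im z| T}` for `0 ≤ x ≤ T`. [folklore] -/
private theorem norm_cexp_I_mul_le (z : ℂ) {x T : ℝ} (hx : 0 ≤ x) (hxT : x ≤ T) :
    ‖cexp (I * z * x)‖ ≤ Real.exp (|z.im| * T) := by
  rw [Complex.norm_exp]
  apply Real.exp_le_exp.2
  have hre : (I * z * (x : ℂ)).re = -(z.im * x) := by simp [Complex.mul_re, Complex.mul_im]
  rw [hre]
  have h1 : -(z.im * x) ≤ |z.im| * x := by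
    have := neg_abs_le z.im
    nlinarith
  have h2 : |z.im| * x ≤ |z.im| * T := mul_le_mul_of_nonneg_left hxT (abs_nonneg _)
  linarith

/-- An affine-exponential piece `x ↦ a + b e^{izx}` is Lipschitz on `[lo, hi] ⊆ [0, T]` with
constant `‖b‖‖z‖e^{|Im z|T}`, and so is any function agreeing with it there. [folklore] -/
private theorem lipschitzOnWith_piece (z a b : ℂ) {lo hi T : ℝ} (hlo : 0 ≤ lo) (hhi : hi ≤ T)
    {f : ℝ → ℂ} (hf : ∀ x ∈ Icc lo hi, f x = a + b * cexp (I * z * x)) :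
    LipschitzOnWith ⟨‖b‖ * ‖z‖ * Real.exp (|z.im| * T), by positivity⟩ f (Icc lo hi) := by
  refine Convex.lipschitzOnWith_of_nnnorm_hasDerivWithin_le (𝕜 := ℝ) (f := f) (s := Icc lo hi)
    (f' := fun x ↦ b * (I * z * cexp (I * z * x))) (by exact convex_Icc lo hi)
    (fun x hx ↦ ?_) (fun x hx ↦ ?_)
  · have h : HasDerivAt (fun y : ℝ ↦ a + b * cexp (I * z * y)) (b * (I * z * cexp (I * z * x))) x := by
      simpa using ((hasDerivAt_cexp_I_mul z x).const_mul b).const_add a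
    exact h.hasDerivWithinAt.congr_of_mem (fun y hy ↦ hf y hy) hx
  · rw [← NNReal.coe_le_coe, coe_nnnorm]
    change ‖b * (I * z * cexp (I * z * x))‖ ≤ ‖b‖ * ‖z‖ * Real.exp (|z.im| * T)
    rw [norm_mul, norm_mul, norm_mul, Complex.norm_I, one_mul]
    have := norm_cexp_I_mul_le z (hlo.trans hx.1) (hx.2.trans hhi)
    have hb : 0 ≤ ‖b‖ * ‖z‖ := by positivity
    calc ‖b‖ * (‖z‖ * ‖cexp (I * z * x)‖) = ‖b‖ * ‖z‖ * ‖cexp (I * z * x)‖ := by ring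
      _ ≤ ‖b‖ * ‖z‖ * Real.exp (|z.im| * T) := mul_le_mul_of_nonneg_left this hb

/-- `g_{z;t,t'}` is Lipschitz for `0 < t ≤ t'` (piecewise `a + b e^{izx}` on `[0,t]`, `[t,t']`,
zero outside `[0, t']`, continuous at the break points). [folklore] -/
private theorem lipschitzWith_suzukiPhiC_of_le (z : ℂ) {t t' : ℝ} (ht : 0 < t) (htt' : t ≤ t')
    (h1 : cexp (-(I * z * t)) ≠ 1) (h2 : cexp (-(I * z * t')) ≠ 1) :
    ∃ K, LipschitzWith K (suzukiPhiC z t t') := by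
  -- the four pieces
  set K₁ : ℝ≥0 := ⟨‖-((suzukiPhiCoeff z t - suzukiPhiCoeff z t') * (I * z)⁻¹)‖ * ‖z‖ *
    Real.exp (|z.im| * t'), by positivity⟩ with hK₁
  set K₂ : ℝ≥0 := ⟨‖(I * z)⁻¹ * (1 + suzukiPhiCoeff z t')‖ * ‖z‖ * Real.exp (|z.im| * t'),
    by positivity⟩ with hK₂
  set K : ℝ≥0 := K₁ + K₂ with hK
  have hp0 : LipschitzOnWith K (suzukiPhiC z t t') (Iic 0) :=
    LipschitzOnWith.of_dist_le_mul fun x hx y hy ↦ by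
      rw [suzukiPhiC_of_nonpos z t t' hx, suzukiPhiC_of_nonpos z t t' hy, dist_self]
      positivity
  have hp1 : LipschitzOnWith K (suzukiPhiC z t t') (Icc 0 t) := by
    refine (lipschitzOnWith_piece z ((suzukiPhiCoeff z t - suzukiPhiCoeff z t') * (I * z)⁻¹)
      (-((suzukiPhiCoeff z t - suzukiPhiCoeff z t') * (I * z)⁻¹)) le_rfl htt' (f := suzukiPhiC z t t')
      (fun x hx ↦ ?_)).weaken (show K₁ ≤ K from self_le_add_right K₁ K₂)
    rw [suzukiPhiC_of_le_of_le z hx.1 hx.2 (hx.2.trans htt')]; ring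
  have hp2 : LipschitzOnWith K (suzukiPhiC z t t') (Icc t t') := by
    refine (lipschitzOnWith_piece z (-(suzukiPhiCoeff z t' * (I * z)⁻¹))
      ((I * z)⁻¹ * (1 + suzukiPhiCoeff z t')) ht.le le_rfl (f := suzukiPhiC z t t')
      (fun x hx ↦ ?_)).weaken (show K₂ ≤ K from self_le_add_left K₂ K₁)
    rcases hx.1.eq_or_lt with rfl | htx
    · -- at `x = t` the two pieces agree: `c_t(1 − e^{izt}) = e^{izt}`
      rw [suzukiPhiC_of_le_of_le z ht.le le_rfl htt']
      have hc := suzukiPhiCoeff_mul_one_sub z h1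
      linear_combination (I * z)⁻¹ * hc
    · rw [suzukiPhiC_of_lt_of_le z ht.le htx hx.2 h1]; ring
  have hp3 : LipschitzOnWith K (suzukiPhiC z t t') (Ici t') := by
    have h0 : ∀ x ∈ Ici t', suzukiPhiC z t t' x = 0 := by
      intro x hx
      rcases (mem_Ici.1 hx).eq_or_lt with rfl | hx'
      · exact suzukiPhiC_apply_right z ht.le htt' h1 h2
      · exact suzukiPhiC_of_max_lt z ht.le (ht.le.trans htt') h1 h2
          (by rw [max_eq_right htt']; exact hx')
    exact LipschitzOnWith.of_dist_le_mul fun x hx y hy ↦ by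
      rw [h0 x hx, h0 y hy, dist_self]; positivity
  -- glue
  have h01 : LipschitzOnWith K (suzukiPhiC z t t') (Iic 0 ∪ Icc 0 t) :=
    lipschitzOnWith_union hp0 hp1 (mem_Iic.2 le_rfl) (left_mem_Icc.2 ht.le) (fun x hx ↦ hx)
      (fun x hx ↦ hx.1)
  have h012 : LipschitzOnWith K (suzukiPhiC z t t') ((Iic 0 ∪ Icc 0 t) ∪ Icc t t') :=
    lipschitzOnWith_union h01 hp2 (Or.inr (right_mem_Icc.2 ht.le)) (left_mem_Icc.2 htt')
      (fun x hx ↦ hx.elim (fun h ↦ (mem_Iic.1 h).trans ht.le) fun h ↦ h.2) (fun x hx ↦ hx.1)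
  have hall : LipschitzOnWith K (suzukiPhiC z t t') (((Iic 0 ∪ Icc 0 t) ∪ Icc t t') ∪ Ici t') :=
    lipschitzOnWith_union h012 hp3 (Or.inr (right_mem_Icc.2 htt')) (mem_Ici.2 le_rfl)
      (fun x hx ↦ hx.elim (fun h ↦ h.elim (fun h ↦ (mem_Iic.1 h).trans (ht.le.trans htt'))
        fun h ↦ h.2.trans htt') fun h ↦ h.2) (fun x hx ↦ hx)
  have huniv : ((Iic 0 ∪ Icc 0 t) ∪ Icc t t') ∪ Ici t' = univ := by
    ext x
    simp only [mem_union, mem_Iic, mem_Icc, mem_Ici, mem_univ, iff_true]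
    rcases le_or_gt x 0 with h | h
    · exact Or.inl (Or.inl (Or.inl h))
    rcases le_or_gt x t with h' | h'
    · exact Or.inl (Or.inl (Or.inr ⟨h.le, h'⟩))
    rcases le_or_gt x t' with h'' | h''
    · exact Or.inl (Or.inr ⟨h'.le, h''⟩)
    · exact Or.inr h''.le
  rw [huniv] at hall
  exact ⟨K, lipschitzOnWith_univ.1 hall⟩

/-- `g_{z;t,t'}` is Lipschitz (`t, t' > 0`, `e^{−izt}, e^{−izt'} ≠ 1`): continuous and piecewise
`a + b e^{izx}`. [cite: Suzuki2025WeilHilbertSpace, proof of Prop. 3.1 (TeX l.795–826)] -/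
theorem lipschitzWith_suzukiPhiC (z : ℂ) {t t' : ℝ} (ht : 0 < t) (ht' : 0 < t')
    (h1 : cexp (-(I * z * t)) ≠ 1) (h2 : cexp (-(I * z * t')) ≠ 1) :
    ∃ K, LipschitzWith K (suzukiPhiC z t t') := by
  rcases le_total t t' with h | h
  · exact lipschitzWith_suzukiPhiC_of_le z ht h h1 h2
  · obtain ⟨K, hK⟩ := lipschitzWith_suzukiPhiC_of_le z ht' h h2 h1
    refine ⟨K, LipschitzWith.of_dist_le_mul fun x y ↦ ?_⟩
    rw [suzukiPhiC_swap z t' t x, suzukiPhiC_swap z t' t y, dist_neg_neg]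
    exact hK.dist_le_mul x y

/-! ## The zero-side transform in closed form -/

/-- `x ↦ e^{cx}` is interval integrable. [folklore] -/
private theorem intervalIntegrable_cexp_mul (c : ℂ) (a b : ℝ) :
    IntervalIntegrable (fun x : ℝ ↦ cexp (c * x)) volume a b :=
  (Complex.continuous_exp.comp (continuous_const.mul Complex.continuous_ofReal)).intervalIntegrable _ _

/-- The rational identity behind `weilMellin_suzukiPhiC` (atoms: `u = iz`, `w = ρ − ½ = −iγ`,
`E = e^{izt}`, `E' = e^{izt'}`, `F = e^{wt}`, `F' = e^{wt'}`). [folklore] -/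
private theorem mellin_algebra {u w E E' F F' : ℂ} (hu : u ≠ 0) (hw : w ≠ 0) (hwu : w + u ≠ 0)
    (hE : E ≠ 0) (hE' : E' ≠ 0) (hne : E⁻¹ - 1 ≠ 0) (hne' : E'⁻¹ - 1 ≠ 0) :
    (E⁻¹ - 1)⁻¹ * ((F - 1) / (w * (w + u))) - (E'⁻¹ - 1)⁻¹ * ((F' - 1) / (w * (w + u))) =
      ((E⁻¹ - 1)⁻¹ - (E'⁻¹ - 1)⁻¹) * u⁻¹ * ((F - 1) / w - (F * E - 1) / (w + u)) +
        (u⁻¹ * (1 + (E'⁻¹ - 1)⁻¹) * ((F' * E' - F * E) / (w + u)) -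
          (E'⁻¹ - 1)⁻¹ * u⁻¹ * ((F' - F) / w)) := by
  have h1E : 1 - E ≠ 0 := by
    intro h
    apply hne
    rw [show E = 1 by linear_combination -h, inv_one, sub_self]
  have h1E' : 1 - E' ≠ 0 := by
    intro h
    apply hne'
    rw [show E' = 1 by linear_combination -h, inv_one, sub_self]
  have hc : (E⁻¹ - 1)⁻¹ = E / (1 - E) := by
    rw [show E⁻¹ - 1 = (1 - E) / E by field_simp, inv_div]
  have hc' : (E'⁻¹ - 1)⁻¹ = E' / (1 - E') := by
    rw [show E'⁻¹ - 1 = (1 - E') / E' by field_simp, inv_div]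
  rw [hc, hc']
  field_simp
  ring

/-- RH-FREE, PROVED — **the zero-side transform of `g_{z;t,t'}` in closed form** (CJM proof of
Prop 3.1, TeX l.822–826: `∫ φ_{z,t}(x)e^{−iγx}dx = (e^{−iγt} − 1)/γ · 1/(z − γ)`): with
`γ = suzukiZeroParam ρ` (so that `weilMellin φ ρ = ∫ φ(x)e^{(ρ−½)x}dx = ∫ φ(x)e^{−iγx}dx`), for
`0 < t ≤ t'`, `γ ≠ 0`, `γ ≠ z`, `z ≠ 0` and `e^{−izt}, e^{−izt'} ≠ 1`,
`weilMellin (suzukiPhiC z t t') ρ = c_t·(e^{−iγt} − 1)/γ·1/(z − γ) − c_{t'}·(e^{−iγt'} − 1)/γ·1/(z − γ)`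
— the summand shape of `screwZeroExpansion` (CJM (3.2)).  For the compact combination the tails
cancel identically, so no half-plane condition is needed. [cite: Suzuki2025WeilHilbertSpace, proof of Prop. 3.1 (TeX l.822–826)] -/
theorem weilMellin_suzukiPhiC_of_le {z : ℂ} {t t' : ℝ} (ht : 0 < t) (htt' : t ≤ t')
    (hz0 : z ≠ 0) (h1 : cexp (-(I * z * t)) ≠ 1) (h2 : cexp (-(I * z * t')) ≠ 1) {ρ : ℂ}
    (hγ0 : suzukiZeroParam ρ ≠ 0) (hγz : suzukiZeroParam ρ ≠ z) :
    weilMellin (suzukiPhiC z t t') ρ =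
      suzukiPhiCoeff z t * ((cexp (-(I * suzukiZeroParam ρ * t)) - 1) / suzukiZeroParam ρ *
          (1 / (z - suzukiZeroParam ρ))) -
        suzukiPhiCoeff z t' * ((cexp (-(I * suzukiZeroParam ρ * t')) - 1) / suzukiZeroParam ρ *
          (1 / (z - suzukiZeroParam ρ))) := by
  set w : ℂ := ρ - 1 / 2 with hw
  have hγ : suzukiZeroParam ρ = I * w := rfl
  have hw0 : w ≠ 0 := by
    intro h; exact hγ0 (by rw [hγ, h, mul_zero])
  have hIz : I * z ≠ 0 := mul_ne_zero I_ne_zero hz0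
  have hden : I * w * (z - I * w) = w * (w + I * z) := by
    ring_nf; rw [I_sq]; ring
  have hwz : w + I * z ≠ 0 := by
    intro h
    have : I * w * (z - I * w) = 0 := by rw [hden, h, mul_zero]
    rcases mul_eq_zero.1 this with h' | h'
    · exact (mul_ne_zero I_ne_zero hw0) h'
    · exact hγz (by rw [hγ]; linear_combination -h')
  have ht' : 0 ≤ t' := ht.le.trans htt'
  -- Step 1: reduce to an interval integral over `(0, t']`
  have hg_cont := continuous_suzukiPhiC z ht.le ht'
  have hF_cont : Continuous fun x : ℝ ↦ suzukiPhiC z t t' x * cexp (w * x) :=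
    hg_cont.mul (Complex.continuous_exp.comp (continuous_const.mul Complex.continuous_ofReal))
  have hzero : ∀ x, x ∉ Ioc 0 t' → suzukiPhiC z t t' x * cexp (w * x) = 0 := by
    intro x hx
    rw [mem_Ioc, not_and_or, not_lt, not_le] at hx
    rcases hx with hx | hx
    · rw [suzukiPhiC_of_nonpos z t t' hx, zero_mul]
    · rw [suzukiPhiC_of_max_lt z ht.le ht' h1 h2 (by rwa [max_eq_right htt']), zero_mul]
  have hM : weilMellin (suzukiPhiC z t t') ρ =
      ∫ x in (0:ℝ)..t', suzukiPhiC z t t' x * cexp (w * x) := by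
    rw [weilMellin, intervalIntegral.integral_of_le ht',
      setIntegral_eq_integral_of_forall_compl_eq_zero hzero]
  -- Step 2: split at `t`
  have hsplit : ∫ x in (0:ℝ)..t', suzukiPhiC z t t' x * cexp (w * x) =
      (∫ x in (0:ℝ)..t, suzukiPhiC z t t' x * cexp (w * x)) +
        ∫ x in t..t', suzukiPhiC z t t' x * cexp (w * x) :=
    (intervalIntegral.integral_add_adjacent_intervals (hF_cont.intervalIntegrable _ _)
      (hF_cont.intervalIntegrable _ _)).symm
  -- Step 3: the piece on `[0, t]`
  have hI1 : ∫ x in (0:ℝ)..t, suzukiPhiC z t t' x * cexp (w * x) =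
      (suzukiPhiCoeff z t - suzukiPhiCoeff z t') * (I * z)⁻¹ *
        ((cexp (w * t) - 1) / w - (cexp ((w + I * z) * t) - 1) / (w + I * z)) := by
    have heq : EqOn (fun x : ℝ ↦ suzukiPhiC z t t' x * cexp (w * x))
        (fun x : ℝ ↦ (suzukiPhiCoeff z t - suzukiPhiCoeff z t') * (I * z)⁻¹ *
          (cexp (w * x) - cexp ((w + I * z) * x))) (uIcc 0 t) := by
      intro x hx
      rw [uIcc_of_le ht.le] at hx
      simp only
      rw [suzukiPhiC_of_le_of_le z hx.1 hx.2 (hx.2.trans htt'), add_mul, Complex.exp_add]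
      ring
    rw [intervalIntegral.integral_congr heq, intervalIntegral.integral_const_mul,
      intervalIntegral.integral_sub (intervalIntegrable_cexp_mul _ _ _)
        (intervalIntegrable_cexp_mul _ _ _),
      integral_exp_mul_complex hw0, integral_exp_mul_complex hwz]
    simp only [Complex.ofReal_zero, mul_zero, Complex.exp_zero]
  -- Step 4: the piece on `[t, t']`
  have hI2 : ∫ x in t..t', suzukiPhiC z t t' x * cexp (w * x) =
      (I * z)⁻¹ * (1 + suzukiPhiCoeff z t') *
          ((cexp ((w + I * z) * t') - cexp ((w + I * z) * t)) / (w + I * z)) -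
        suzukiPhiCoeff z t' * (I * z)⁻¹ * ((cexp (w * t') - cexp (w * t)) / w) := by
    have heq : ∀ᵐ x : ℝ, x ∈ uIoc t t' → suzukiPhiC z t t' x * cexp (w * x) =
        (I * z)⁻¹ * (1 + suzukiPhiCoeff z t') * cexp ((w + I * z) * x) -
          suzukiPhiCoeff z t' * (I * z)⁻¹ * cexp (w * x) := by
      refine Eventually.of_forall fun x hx ↦ ?_
      rw [uIoc_of_le htt'] at hx
      rw [suzukiPhiC_of_lt_of_le z ht.le hx.1 hx.2 h1, add_mul, Complex.exp_add]
      ring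
    rw [intervalIntegral.integral_congr_ae heq,
      intervalIntegral.integral_sub ((intervalIntegrable_cexp_mul _ _ _).const_mul _)
        ((intervalIntegrable_cexp_mul _ _ _).const_mul _),
      intervalIntegral.integral_const_mul, intervalIntegral.integral_const_mul,
      integral_exp_mul_complex hwz, integral_exp_mul_complex hw0]
  -- Step 5: algebra
  rw [hM, hsplit, hI1, hI2, hγ]
  have hE : cexp (I * z * t) ≠ 0 := Complex.exp_ne_zero _
  have hE' : cexp (I * z * t') ≠ 0 := Complex.exp_ne_zero _
  have hne : (cexp (I * z * t))⁻¹ - 1 ≠ 0 := by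
    rw [← Complex.exp_neg]; exact sub_ne_zero.2 h1
  have hne' : (cexp (I * z * t'))⁻¹ - 1 ≠ 0 := by
    rw [← Complex.exp_neg]; exact sub_ne_zero.2 h2
  have hexp : ∀ s : ℂ, cexp (-(I * (I * w) * s)) = cexp (w * s) := by
    intro s; congr 1; ring_nf; rw [I_sq]; ring
  have hquot : ∀ X : ℂ, X / (I * w) * (1 / (z - I * w)) = X / (w * (w + I * z)) := by
    intro X; rw [div_mul_div_comm, mul_one, hden]
  rw [hexp, hexp, hquot, hquot, suzukiPhiCoeff, suzukiPhiCoeff, Complex.exp_neg, Complex.exp_neg,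
    show (w + I * z) * (t : ℂ) = w * t + I * z * t by ring,
    show (w + I * z) * (t' : ℂ) = w * t' + I * z * t' by ring, Complex.exp_add, Complex.exp_add]
  exact (mellin_algebra hIz hw0 hwz hE hE' hne hne').symm

/-- RH-FREE, PROVED — `weilMellin_suzukiPhiC_of_le` without the ordering of `t, t'` (antisymmetry).
[cite: Suzuki2025WeilHilbertSpace, proof of Prop. 3.1 (TeX l.822–826)] -/
theorem weilMellin_suzukiPhiC {z : ℂ} {t t' : ℝ} (ht : 0 < t) (ht' : 0 < t')
    (hz0 : z ≠ 0) (h1 : cexp (-(I * z * t)) ≠ 1) (h2 : cexp (-(I * z * t')) ≠ 1) {ρ : ℂ}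
    (hγ0 : suzukiZeroParam ρ ≠ 0) (hγz : suzukiZeroParam ρ ≠ z) :
    weilMellin (suzukiPhiC z t t') ρ =
      suzukiPhiCoeff z t * ((cexp (-(I * suzukiZeroParam ρ * t)) - 1) / suzukiZeroParam ρ *
          (1 / (z - suzukiZeroParam ρ))) -
        suzukiPhiCoeff z t' * ((cexp (-(I * suzukiZeroParam ρ * t')) - 1) / suzukiZeroParam ρ *
          (1 / (z - suzukiZeroParam ρ))) := by
  rcases le_total t t' with h | h
  · exact weilMellin_suzukiPhiC_of_le ht h hz0 h1 h2 hγ0 hγz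
  · have hswap : suzukiPhiC z t t' = fun x ↦ -suzukiPhiC z t' t x :=
      funext fun x ↦ by rw [suzukiPhiC_swap z t' t x]
    have hneg : weilMellin (suzukiPhiC z t t') ρ = -weilMellin (suzukiPhiC z t' t) ρ := by
      rw [hswap, weilMellin, weilMellin, ← integral_neg]
      congr 1; ext x; ring
    rw [hneg, weilMellin_suzukiPhiC_of_le ht' h hz0 h2 h1 hγ0 hγz]
    ring

/-- RH-FREE, PROVED — the zero-side transform is `O(1/(|γ||z − γ|))` across the strip: for
`0 < Re ρ < 1` (so `|e^{−iγt}| = e^{(Re ρ − ½)t} ≤ e^{t/2}`),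
`‖ĝ(ρ)‖ ≤ (‖c_t‖(e^{t/2} + 1) + ‖c_{t'}‖(e^{t'/2} + 1)) / (‖γ‖·‖z − γ‖)` — the input for the absolute
convergence of the zero side (`Σ_γ m_γ|γ|^{−1−δ} < ∞`, CJM TeX l.776–781).
[cite: Suzuki2025WeilHilbertSpace, proof of Prop. 3.1 (TeX l.776–781, 822–830)] -/
theorem norm_weilMellin_suzukiPhiC_le {z : ℂ} {t t' : ℝ} (ht : 0 < t) (ht' : 0 < t')
    (hz0 : z ≠ 0) (h1 : cexp (-(I * z * t)) ≠ 1) (h2 : cexp (-(I * z * t')) ≠ 1) {ρ : ℂ}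
    (hρ1 : ρ.re < 1) (hγ0 : suzukiZeroParam ρ ≠ 0) (hγz : suzukiZeroParam ρ ≠ z) :
    ‖weilMellin (suzukiPhiC z t t') ρ‖ ≤
      (‖suzukiPhiCoeff z t‖ * (Real.exp (t / 2) + 1) +
          ‖suzukiPhiCoeff z t'‖ * (Real.exp (t' / 2) + 1)) /
        (‖suzukiZeroParam ρ‖ * ‖z - suzukiZeroParam ρ‖) := by
  have hF : ∀ {s : ℝ}, 0 < s → ‖cexp (-(I * suzukiZeroParam ρ * s))‖ ≤ Real.exp (s / 2) := by
    intro s hs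
    rw [Complex.norm_exp]
    apply Real.exp_le_exp.2
    have : (-(I * suzukiZeroParam ρ * (s : ℂ))).re = (ρ.re - 1 / 2) * s := by
      simp [suzukiZeroParam, Complex.mul_re, Complex.mul_im]; ring
    rw [this]
    nlinarith
  have hzγ : z - suzukiZeroParam ρ ≠ 0 := sub_ne_zero.2 (Ne.symm hγz)
  rw [weilMellin_suzukiPhiC ht ht' hz0 h1 h2 hγ0 hγz,
    show suzukiPhiCoeff z t * ((cexp (-(I * suzukiZeroParam ρ * t)) - 1) / suzukiZeroParam ρ *
        (1 / (z - suzukiZeroParam ρ))) -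
      suzukiPhiCoeff z t' * ((cexp (-(I * suzukiZeroParam ρ * t')) - 1) / suzukiZeroParam ρ *
        (1 / (z - suzukiZeroParam ρ))) =
      (suzukiPhiCoeff z t * (cexp (-(I * suzukiZeroParam ρ * t)) - 1) -
        suzukiPhiCoeff z t' * (cexp (-(I * suzukiZeroParam ρ * t')) - 1)) /
        (suzukiZeroParam ρ * (z - suzukiZeroParam ρ)) by
      field_simp,
    norm_div, norm_mul]
  apply div_le_div_of_nonneg_right _ (by positivity)
  refine (norm_sub_le _ _).trans (add_le_add ?_ ?_)
  · rw [norm_mul]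
    refine mul_le_mul_of_nonneg_left ((norm_sub_le _ _).trans ?_) (norm_nonneg _)
    rw [norm_one]; linarith [hF ht]
  · rw [norm_mul]
    refine mul_le_mul_of_nonneg_left ((norm_sub_le _ _).trans ?_) (norm_nonneg _)
    rw [norm_one]; linarith [hF ht']

/-! ## The polar term `ĝ(0) + ĝ(1)` in closed form -/

/-- `Im z > 1` puts `z` off `0` and `±i/2` and makes `e^{−izt} ≠ 1` for `t > 0`. [folklore] -/
private theorem ne_of_one_lt_im {z : ℂ} (hz : 1 < z.im) :
    z ≠ 0 ∧ suzukiZeroParam 1 ≠ z ∧ suzukiZeroParam 0 ≠ z := by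
  refine ⟨fun h ↦ ?_, fun h ↦ ?_, fun h ↦ ?_⟩
  · rw [h] at hz; simp at hz; linarith
  · have := congrArg Complex.im h
    simp [suzukiZeroParam] at this; linarith
  · have := congrArg Complex.im h
    simp [suzukiZeroParam] at this; linarith

/-- The `γ = ∓i/2` evaluations: `(X − 1)/γ · 1/(z − γ)` at `γ = i/2` is `4(X − 1)/(1 + 2iz)` and at
`γ = −i/2` is `4(X − 1)/(1 − 2iz)`. [folklore] -/
private theorem polar_piece_one {z : ℂ} (hz : suzukiZeroParam 1 ≠ z) (X : ℂ) :
    (X - 1) / suzukiZeroParam 1 * (1 / (z - suzukiZeroParam 1)) = 4 * (X - 1) / (1 + 2 * I * z) := by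
  have hγ : suzukiZeroParam 1 = I / 2 := by simp [suzukiZeroParam]; ring
  rw [hγ] at hz ⊢
  have hne : z - I / 2 ≠ 0 := sub_ne_zero.2 (Ne.symm hz)
  have hprod : I / 2 * (z - I / 2) = (1 + 2 * I * z) / 4 := by ring_nf; rw [I_sq]; ring
  have hne' : 1 + 2 * I * z ≠ 0 := by
    intro h; apply hne
    have : I / 2 * (z - I / 2) = 0 := by rw [hprod, h, zero_div]
    simpa [I_ne_zero] using this
  rw [div_mul_div_comm, mul_one, hprod, div_div_eq_mul_div]
  ring

/-- The `γ = −i/2` evaluation: `(X − 1)/γ · 1/(z − γ) = 4(X − 1)/(1 − 2iz)`. [folklore] -/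
private theorem polar_piece_zero {z : ℂ} (hz : suzukiZeroParam 0 ≠ z) (X : ℂ) :
    (X - 1) / suzukiZeroParam 0 * (1 / (z - suzukiZeroParam 0)) = 4 * (X - 1) / (1 - 2 * I * z) := by
  have hγ : suzukiZeroParam 0 = -(I / 2) := by simp [suzukiZeroParam]; ring
  rw [hγ] at hz ⊢
  have hne : z - -(I / 2) ≠ 0 := sub_ne_zero.2 (Ne.symm hz)
  have hprod : -(I / 2) * (z - -(I / 2)) = (1 - 2 * I * z) / 4 := by ring_nf; rw [I_sq]; ring
  rw [div_mul_div_comm, mul_one, hprod, div_div_eq_mul_div]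
  ring

/-- RH-FREE, PROVED — **the polar term of `g_{z;t,t'}`** (CJM proof of Prop 3.1, TeX l.836–840:
`∫ φ_{z,t}(x)(e^{x/2} + e^{−x/2})dx = 4(e^{t/2} − 1)/(1 + 2iz) + 4(e^{−t/2} − 1)/(1 − 2iz)`), for
`Im z > 1` and `t, t' > 0`: `ĝ(0) + ĝ(1) = c_t·[4(e^{t/2}−1)/(1+2iz) + 4(e^{−t/2}−1)/(1−2iz)] − c_{t'}·[…t'…]`
— the first two terms of `screwP` (CJM (1.6)).  A corollary of `weilMellin_suzukiPhiC` at `ρ = 1, 0`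
(`γ = ±i/2`). [cite: Suzuki2025WeilHilbertSpace, proof of Prop. 3.1 (TeX l.836–840)] -/
theorem weilPolarTerm_suzukiPhiC {z : ℂ} (hz : 1 < z.im) {t t' : ℝ} (ht : 0 < t) (ht' : 0 < t') :
    weilPolarTerm (suzukiPhiC z t t') =
      suzukiPhiCoeff z t * (4 * ((Real.exp (t / 2) - 1 : ℝ) : ℂ) / (1 + 2 * I * z) +
          4 * ((Real.exp (-(t / 2)) - 1 : ℝ) : ℂ) / (1 - 2 * I * z)) -
        suzukiPhiCoeff z t' * (4 * ((Real.exp (t' / 2) - 1 : ℝ) : ℂ) / (1 + 2 * I * z) +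
          4 * ((Real.exp (-(t' / 2)) - 1 : ℝ) : ℂ) / (1 - 2 * I * z)) := by
  obtain ⟨hz0, hz1, hzm⟩ := ne_of_one_lt_im hz
  have hzpos : 0 < z.im := zero_lt_one.trans hz
  have h1 := cexp_neg_I_mul_ne_one hzpos ht
  have h2 := cexp_neg_I_mul_ne_one hzpos ht'
  have hγ1 : suzukiZeroParam 1 ≠ 0 := by simp [suzukiZeroParam, I_ne_zero]; norm_num
  have hγ0 : suzukiZeroParam 0 ≠ 0 := by simp [suzukiZeroParam, I_ne_zero]
  rw [weilPolarTerm, weilMellin_suzukiPhiC ht ht' hz0 h1 h2 hγ0 hzm,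
    weilMellin_suzukiPhiC ht ht' hz0 h1 h2 hγ1 hz1, polar_piece_one hz1, polar_piece_one hz1,
    polar_piece_zero hzm, polar_piece_zero hzm]
  have e1 : ∀ s : ℝ, cexp (-(I * suzukiZeroParam 1 * s)) = ((Real.exp (s / 2) : ℝ) : ℂ) := by
    intro s
    rw [Complex.ofReal_exp]; congr 1
    simp only [suzukiZeroParam]; push_cast; ring_nf; rw [I_sq]; ring
  have e0 : ∀ s : ℝ, cexp (-(I * suzukiZeroParam 0 * s)) = ((Real.exp (-(s / 2)) : ℝ) : ℂ) := by
    intro s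
    rw [Complex.ofReal_exp]; congr 1
    simp only [suzukiZeroParam]; push_cast; ring_nf; rw [I_sq]; ring
  rw [e1, e1, e0, e0]
  push_cast
  ring

/-! ## The prime term in closed form (a finite sum: the `ζ'/ζ` terms cancel) -/

/-- The prime term as a finite sum when the test function vanishes for `|u| > R` (tree
`WeilContinuous.weilPrimeTerm_eq_sum_of_support`, restated to keep this module's imports light). [folklore] -/
private theorem weilPrimeTerm_eq_sum_of_support' {f : ℝ → ℂ} {R : ℝ}
    (hf : ∀ u : ℝ, R < |u| → f u = 0) :
    weilPrimeTerm f = ∑ n ∈ Finset.range ⌈Real.exp (R + 1)⌉₊,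
      ((ArithmeticFunction.vonMangoldt n : ℝ) : ℂ) / (Real.sqrt n : ℂ) *
        (f (Real.log n) + f (-Real.log n)) := by
  unfold weilPrimeTerm
  refine tsum_eq_sum fun n hn ↦ ?_
  rw [Finset.mem_range, not_lt] at hn
  have hn' : Real.exp (R + 1) ≤ n := (Nat.le_ceil _).trans (by exact_mod_cast hn)
  have hpos : (0 : ℝ) < n := (Real.exp_pos _).trans_le hn'
  have hlog : R + 1 ≤ Real.log n := by rwa [Real.le_log_iff_exp_le hpos]
  have h1 : R < |Real.log n| := lt_of_lt_of_le (by linarith) (le_abs_self _)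
  rw [hf _ h1, hf _ (by rwa [abs_neg]), add_zero, mul_zero]

/-- RH-FREE, PROVED — **the prime term of `g_{z;t,t'}`** for `0 < t ≤ t'` (CJM proof of Prop 3.1,
TeX l.841–861: `Σ_n Λ(n)n^{−1/2}φ_{z,t}(log n) = −Σ_{n≤e^t} Λ(n)n^{−1/2}(e^{−iz(t−log n)}−1)/(iz)
− (e^{−izt}−1)/(iz)·ζ'/ζ(½−iz)`, `Σ_n Λ(n)n^{−1/2}φ_{z,t}(−log n) = 0`): for the compact
combination the two `ζ'/ζ(½ − iz)` contributions are both `(iz)⁻¹ζ'/ζ(½ − iz)` and CANCEL, leaving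
the finite sums of `screwP` (CJM (1.6), fourth term):
`Σ_n Λ(n)n^{−1/2}(g(log n) + g(−log n)) = −(c_t·Σ_{n≤e^t}Λ(n)n^{−1/2}(e^{−iz(t−log n)}−1)/(iz) − c_{t'}·Σ_{n≤e^{t'}}…)`.
[cite: Suzuki2025WeilHilbertSpace, proof of Prop. 3.1 (TeX l.841–861)] -/
theorem weilPrimeTerm_suzukiPhiC_of_le {z : ℂ} (hz : 0 < z.im) {t t' : ℝ} (ht : 0 < t)
    (htt' : t ≤ t') :
    weilPrimeTerm (suzukiPhiC z t t') =
      -(suzukiPhiCoeff z t * ∑ n ∈ Finset.Icc 1 ⌊Real.exp t⌋₊,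
          ((ArithmeticFunction.vonMangoldt n / Real.sqrt n : ℝ) : ℂ) *
            ((cexp (-(I * z * ((t - Real.log n : ℝ) : ℂ))) - 1) / (I * z)) -
        suzukiPhiCoeff z t' * ∑ n ∈ Finset.Icc 1 ⌊Real.exp t'⌋₊,
          ((ArithmeticFunction.vonMangoldt n / Real.sqrt n : ℝ) : ℂ) *
            ((cexp (-(I * z * ((t' - Real.log n : ℝ) : ℂ))) - 1) / (I * z))) := by
  have ht' : 0 < t' := ht.trans_le htt'
  have h1 := cexp_neg_I_mul_ne_one hz ht
  have h2 := cexp_neg_I_mul_ne_one hz ht'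
  -- support: `g(u) = 0` for `|u| > t'`
  have hsupp : ∀ u : ℝ, t' < |u| → suzukiPhiC z t t' u = 0 := by
    intro u hu
    rcases le_or_gt u 0 with hu0 | hu0
    · exact suzukiPhiC_of_nonpos z t t' hu0
    · rw [abs_of_pos hu0] at hu
      exact suzukiPhiC_of_max_lt z ht.le ht'.le h1 h2 (by rwa [max_eq_right htt'])
  rw [weilPrimeTerm_eq_sum_of_support' hsupp]
  set M := ⌈Real.exp (t' + 1)⌉₊ with hM
  -- both finite ranges sit inside `range M`
  have hsub : ∀ {τ : ℝ}, τ ≤ t' → Finset.Icc 1 ⌊Real.exp τ⌋₊ ⊆ Finset.range M := by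
    intro τ hτ n hn
    rw [Finset.mem_Icc] at hn
    rw [Finset.mem_range]
    have h : (⌊Real.exp τ⌋₊ : ℝ) < M :=
      calc (⌊Real.exp τ⌋₊ : ℝ) ≤ Real.exp τ := Nat.floor_le (Real.exp_pos τ).le
        _ < Real.exp (t' + 1) := Real.exp_lt_exp.2 (by linarith)
        _ ≤ M := Nat.le_ceil _
    exact lt_of_le_of_lt hn.2 (by exact_mod_cast h)
  have hA : ∀ {τ : ℝ}, τ ≤ t' →
      (∑ n ∈ Finset.Icc 1 ⌊Real.exp τ⌋₊,
          ((ArithmeticFunction.vonMangoldt n / Real.sqrt n : ℝ) : ℂ) *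
            ((cexp (-(I * z * ((τ - Real.log n : ℝ) : ℂ))) - 1) / (I * z))) =
        ∑ n ∈ Finset.range M, if n ∈ Finset.Icc 1 ⌊Real.exp τ⌋₊ then
          ((ArithmeticFunction.vonMangoldt n / Real.sqrt n : ℝ) : ℂ) *
            ((cexp (-(I * z * ((τ - Real.log n : ℝ) : ℂ))) - 1) / (I * z)) else 0 := by
    intro τ hτ
    rw [Finset.sum_ite_mem, Finset.inter_eq_right.2 (hsub hτ)]
  rw [hA htt', hA le_rfl, Finset.mul_sum, Finset.mul_sum, ← Finset.sum_sub_distrib,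
    ← Finset.sum_neg_distrib]
  refine Finset.sum_congr rfl fun n _ ↦ ?_
  rcases Nat.eq_zero_or_pos n with rfl | hn1
  · simp
  · have hx0 : 0 ≤ Real.log n := Real.log_natCast_nonneg n
    have hnpos : (0 : ℝ) < n := by exact_mod_cast hn1
    have hmem : ∀ τ : ℝ, n ∈ Finset.Icc 1 ⌊Real.exp τ⌋₊ ↔ Real.log n ≤ τ := by
      intro τ
      rw [Finset.mem_Icc, Nat.le_floor_iff (Real.exp_pos τ).le, Real.log_le_iff_le_exp hnpos]
      exact ⟨fun h ↦ h.2, fun h ↦ ⟨hn1, h⟩⟩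
    have hE : ∀ τ : ℝ, cexp (-(I * z * ((τ - Real.log n : ℝ) : ℂ))) =
        cexp (-(I * z * τ)) * cexp (I * z * (Real.log n : ℝ)) := by
      intro τ; rw [← Complex.exp_add]; congr 1; push_cast; ring
    have hc := suzukiPhiCoeff_mul z h1
    have hc' := suzukiPhiCoeff_mul z h2
    have hcast : ((ArithmeticFunction.vonMangoldt n / Real.sqrt n : ℝ) : ℂ) =
        ((ArithmeticFunction.vonMangoldt n : ℝ) : ℂ) / (Real.sqrt n : ℂ) := by push_cast; rfl
    rw [suzukiPhiC_of_nonpos z t t' (neg_nonpos.2 hx0), add_zero]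
    simp only [hmem, hcast, hE]
    by_cases hnt : Real.log n ≤ t
    · have hnt' : Real.log n ≤ t' := hnt.trans htt'
      rw [if_pos hnt, if_pos hnt', suzukiPhiC_of_le_of_le z hx0 hnt hnt']
      linear_combination (((ArithmeticFunction.vonMangoldt n : ℝ) : ℂ) / (Real.sqrt n : ℂ) *
          cexp (I * z * (Real.log n : ℝ)) / (I * z)) * hc -
        (((ArithmeticFunction.vonMangoldt n : ℝ) : ℂ) / (Real.sqrt n : ℂ) *
          cexp (I * z * (Real.log n : ℝ)) / (I * z)) * hc'
    · rw [if_neg hnt]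
      by_cases hnt' : Real.log n ≤ t'
      · rw [if_pos hnt', suzukiPhiC_of_lt_of_le z ht.le (not_le.1 hnt) hnt' h1]
        linear_combination (-(((ArithmeticFunction.vonMangoldt n : ℝ) : ℂ) / (Real.sqrt n : ℂ) *
          cexp (I * z * (Real.log n : ℝ)) / (I * z))) * hc'
      · rw [if_neg hnt', suzukiPhiC_of_max_lt z ht.le ht'.le h1 h2
          (by rw [max_eq_right htt']; exact not_le.1 hnt')]
        ring

end Literature.NumberTheory.LFunctions
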